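import Summits.HodgeConjecture.HodgeConjecture.Theorems.VHCAbelianSchemesRoadSecantQuotientPinnedWeilPlaneRigidityEndDefs
import Summits.HodgeConjecture.HodgeConjecture.Theorems.VHCAbelianSchemesRoadSecantQuotientPinnedRigidityOfEndInt
import HarnessLib

/-!
# Road №4 (`VHCAbelianSchemesRoad`) — THE REPAIRED NODE (P2♭) `SecantQuotientPinnedWeilPlaneRigidityOfEndTrivial` IS A THEOREM
# (crux stmt-HodgeConjecture-26512, skeleton v3.12 d2dc433d1981f4c8, child (c3″))

research route conditional on HC_CM; not a corollary; Q11.4-sentence-2 already refuted in dim ≥ 3.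

PROOF ONLY (ring2-b03x gen 15; director-hodge g14 R14.38 (1)+(3), director-hodge g16 R16.1 (2)). The node (P2♭) (ring2 LEAD 163's
`…SecantQuotientPinnedWeilPlaneRigidityEndDefs`, the repair of record of (P2) keyed by End-triviality) is DISCHARGED: its statement is, definitionally,
the theorem `pinnedWeilPlaneRigidity_offHypDisj_of_endRingInt` of `…SecantQuotientPinnedRigidityOfEndInt` (p646524, over the frame algebra p645155) — at a
datum whose Jacobian has only integer endomorphisms every class pinned-served at the datum's own pinned chart, through any presentation, pulls back under
`q` into the datum's own Weil plane (`SecantQuotientDatum.pinnedWeilPlaneRigidityAt_of_endRingInt`). So the node is no longer a displayed input anywhere.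

Nothing here says (P2) (refuted modulo `H` at `Aut`-symmetric data, p645590), (P1), (c1), (c4a), 2r″, 26512 ∕ 26511 ∕ 23176, `HC_AV` or HC holds; HC_CM HELD,
by name only. References: [cite: Markman2025SecantWeil, Thm. 1.4.1 (item 4), §1.3 (p. 5) and §1.5 (p. 7)] [cite: vanGeemen1994HodgeAV, 4.9 and Lemma 5.2 (5)]
[cite: MoonenZarhin1998WeilClasses, §1] [cite: MumfordAV1970, §19–§20].
-/

noncomputable section

open CategoryTheory CategoryTheory.Limits AlgebraicGeometry Topology

namespace Summit.HodgeConjecture.HodgeConjecture.Ring2.SemiregularRepresentatives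

set_option linter.dupNamespace false -- the cell's namespace repeats the summit name, as in every `Ring2*` file

open Literature.AlgebraicGeometry Literature.AlgebraicGeometry.Motives Literature.AlgebraicGeometry.Motives.AbelianVariety
open Literature.AlgebraicGeometry.HodgeTheory Literature.AlgebraicGeometry.Markman2025
open Literature.AlgebraicTopology.SingularHomology

/-- **(P2♭) HOLDS: `SecantQuotientPinnedWeilPlaneRigidityOfEndTrivial` is a theorem** — Weil-plane rigidity of the pinned served set at every
non-hyperelliptic, H-good, `End`-trivial secant–quotient datum (the first two hypotheses are not even used), by
`SecantQuotientDatum.pinnedWeilPlaneRigidityAt_of_endRingInt` (p646524). [cite: Markman2025SecantWeil, Thm. 1.4.1 (item 4) and §1.5 (p. 7)]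
[cite: vanGeemen1994HodgeAV, 4.9 and Lemma 5.2 (5)] [cite: MoonenZarhin1998WeilClasses, §1] -/
theorem secantQuotientPinnedWeilPlaneRigidityOfEndTrivial_holds : SecantQuotientPinnedWeilPlaneRigidityOfEndTrivial :=
  secantQuotientPinnedWeilPlaneRigidityOfEndTrivial_iff.2 pinnedWeilPlaneRigidity_offHypDisj_of_endRingInt

end Summit.HodgeConjecture.HodgeConjecture.Ring2.SemiregularRepresentatives

end
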